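import Summits.QuantumFields.YangMills.Theorems.IR.SmallFieldCoderS2LawStep

/-!
# S₂∕C3 (3/4): locality predicates, the graded locality step over `t·M`, arithmetic of the constants

Landed for item `stmt-QuantumFields-19354` (`--supports … --as helper`) by the LEAD prover ab-p1 (director-ym №14 (3) landing lane; ideator's OFFER
2026-08-28T05:58:49Z); authored by ideator ym-ir-idea-4 g4, split of the sorry-free workfile `Cruxes/IR/Lines/smallfield_polymer_coder_S2.lean` rev 2
(94b95b4dc241) per `Cruxes/IR/Lines/smallfield_polymer_coder_S2_LANDING.md` v2 (four files `SmallFieldCoderS2{Nesting,LawStep,Locality,Iterate}`).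

Content (§S2.3b–§S2.4): `LocalAt`, `GradedLocal` (+ monotonicity), `gradedLocal_step` (corner-link union bound `≤ 64(2R'+3)^4`, uniform in `M`, `t`),
`exp_four_ge`, `tailConst`, `tail_step_arith` and the remaining constant bookkeeping.

HONESTY: plumbing only (measure theory ∕ arithmetic over `Theorems/IR/TelescopedCoding*`) — nothing here bears on the Clay Yang–Mills mass gap, a lattice gap or `BalabanLadder.IR`; R4 of the ladder closes only the conditional finite-𝕋⁴ rung `BalabanLadder.UV`.
-/

set_option autoImplicit false

noncomputable section

open MeasureTheory
open Literature.MathematicalPhysics.QuantumFieldTheory Literature.MathematicalPhysics.QuantumLattice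
open Summit.QuantumFields.YangMills.Cruxes.IR.TelescopedCoding

namespace Summit.QuantumFields.YangMills.Cruxes.IR.SmallFieldPolymerCoder

/-! ## §S2.3b Locality predicates and the graded locality step -/

section LocStep

variable {G : Type} [Group G] [TopologicalSpace G] [IsTopologicalGroup G] [CompactSpace G]
  [MeasurableSpace G] [BorelSpace G] [SecondCountableTopology G]

variable {N : ℕ} (ρ : G →* Matrix (Fin N) (Fin N) ℂ) (β : ℝ)

/-- `f (V, ω)` reads `V` and the link coordinates of `ω` only inside the input ball of radius `R` around `e`
(the locality clause of the conditional formats, named). -/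
def LocalAt (S : ℕ) (e : ZdEdge 4) (R : ℕ) (f : GaugeConfig 4 (2 * S + 1) G × Noise G (2 * S + 1) → G) : Prop :=
  ∀ p q : GaugeConfig 4 (2 * S + 1) G × Noise G (2 * S + 1),
    (∀ x ∈ inputBall (2 * S + 1) e R, p.1 x = q.1 x) →
    (∀ y : ℕ × Edge 4 (2 * S + 1), y.2 ∈ inputBall (2 * S + 1) e R → p.2 y = q.2 y) → f p = f q

omit [Group G] [TopologicalSpace G] [IsTopologicalGroup G] [CompactSpace G] [MeasurableSpace G] [BorelSpace G]
  [SecondCountableTopology G] in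
/-- `LocalAt` is monotone in the radius. -/
theorem localAt_mono {S : ℕ} {e : ZdEdge 4} {R R' : ℕ} (h : R ≤ R')
    {f : GaugeConfig 4 (2 * S + 1) G × Noise G (2 * S + 1) → G} (hf : LocalAt S e R f) : LocalAt S e R' f :=
  fun p q h1 h2 => hf p q (fun x hx => h1 x (inputBall_mono e h hx)) (fun y hy => h2 y (inputBall_mono e h hy))

/-- **Graded locality** of a sampler `Ψ` under the input law `π`: for every link and every parameter `s ≥ 1` a measurable local
surrogate at radius `R s`, wrong with `π`-mass `≤ T s`. -/
def GradedLocal (S : ℕ) (π : Measure (GaugeConfig 4 (2 * S + 1) G × Noise G (2 * S + 1)))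
    (Ψ : GaugeConfig 4 (2 * S + 1) G × Noise G (2 * S + 1) → GaugeConfig 4 (2 * S + 1) G) (R : ℕ → ℕ) (T : ℕ → ℝ) : Prop :=
  ∀ (e : ZdEdge 4) (s : ℕ), 1 ≤ s → ∃ Ψ' : GaugeConfig 4 (2 * S + 1) G × Noise G (2 * S + 1) → G, Measurable Ψ' ∧
    LocalAt S e (R s) Ψ' ∧ π {p | Ψ p (torusEdge (2 * S + 1) e) ≠ Ψ' p} ≤ ENNReal.ofReal (T s)

omit [Group G] [TopologicalSpace G] [IsTopologicalGroup G] [CompactSpace G] [BorelSpace G] [SecondCountableTopology G] in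
/-- `GradedLocal` is monotone in the radius profile and the tail profile. -/
theorem gradedLocal_mono {S : ℕ} {π : Measure (GaugeConfig 4 (2 * S + 1) G × Noise G (2 * S + 1))}
    {Ψ : GaugeConfig 4 (2 * S + 1) G × Noise G (2 * S + 1) → GaugeConfig 4 (2 * S + 1) G} {R R' : ℕ → ℕ} {T T' : ℕ → ℝ}
    (hR : ∀ s, 1 ≤ s → R s ≤ R' s) (hT : ∀ s, 1 ≤ s → T s ≤ T' s) (h : GradedLocal S π Ψ R T) : GradedLocal S π Ψ R' T' := by
  intro e s hs
  obtain ⟨Ψ', hm, hloc, hbad⟩ := h e s hs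
  exact ⟨Ψ', hm, localAt_mono (hR s hs) hloc, hbad.trans (ENNReal.ofReal_le_ofReal (hT s hs))⟩

/-- **The graded locality step** (union bound over the `M`-corner links of the lower input ball, counted uniformly in `M`;
the lower stage is run at parameter `s + 4`, the upper stage at `s`). -/
theorem gradedLocal_step {S M b t : ℕ} (hM : 0 < M) (hMN : M ≤ 2 * S + 1) {K : ℝ} (hK : 0 ≤ K)
    {C B : GaugeConfig 4 (2 * S + 1) G × Noise G (2 * S + 1) → GaugeConfig 4 (2 * S + 1) G}
    (_hC : Measurable C) (hB : Measurable B)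
    (hBlaw : (((wilsonMeasure (d := 4) (L := 2 * S + 1) ρ β).map (blockField (t * M) (2 * S + 1))).prod
        (seqNoise G (2 * S + 1))).map (fun p => (p.1, B p)) =
      (wilsonMeasure (d := 4) (L := 2 * S + 1) ρ β).map
        (fun U => (blockField (t * M) (2 * S + 1) U, blockField M (2 * S + 1) U)))
    {R₁ : ℕ → ℕ} {T₁ : ℕ → ℝ} (hT₁ : ∀ s, 0 ≤ T₁ s)
    (hCloc : GradedLocal S (((wilsonMeasure (d := 4) (L := 2 * S + 1) ρ β).map (blockField M (2 * S + 1))).prod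
        (seqNoise G (2 * S + 1))) C R₁ T₁)
    (hBloc : ∀ (e : ZdEdge 4) (k : ℕ), 1 ≤ k →
      ∃ B' : GaugeConfig 4 (2 * S + 1) G × Noise G (2 * S + 1) → G, Measurable B' ∧
        LocalAt S e (k * (t * M * b)) B' ∧
        (((wilsonMeasure (d := 4) (L := 2 * S + 1) ρ β).map (blockField (t * M) (2 * S + 1))).prod (seqNoise G (2 * S + 1)))
            {p | B p (torusEdge (2 * S + 1) e) ≠ B' p} ≤ ENNReal.ofReal (K * Real.exp (-(k : ℝ))))
    {R' : ℕ → ℕ} (hR' : ∀ s, R₁ (s + 4) ≤ M * R' s) :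
    GradedLocal S (((wilsonMeasure (d := 4) (L := 2 * S + 1) ρ β).map (blockField (t * M) (2 * S + 1))).prod
        (seqNoise G (2 * S + 1)))
      (fun p => C (reblock M (2 * S + 1) (B (p.1, evenPart p.2)), oddPart p.2))
      (fun s => M * R' s + M + s * (t * M * b))
      (fun s => T₁ (s + 4) + 64 * ((2 * R' s + 3 : ℕ) : ℝ) ^ 4 * (K * Real.exp (-(s : ℝ)))) := by
  classical
  haveI : IsProbabilityMeasure (seqNoise G (2 * S + 1)) := isProbabilityMeasure_seqNoise _
  haveI : NeZero (2 * S + 1) := ⟨by omega⟩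
  intro e s hs
  set π₂ := ((wilsonMeasure (d := 4) (L := 2 * S + 1) ρ β).map (blockField (t * M) (2 * S + 1))).prod
    (seqNoise G (2 * S + 1)) with hπ₂
  set π₁ := ((wilsonMeasure (d := 4) (L := 2 * S + 1) ρ β).map (blockField M (2 * S + 1))).prod
    (seqNoise G (2 * S + 1)) with hπ₁
  -- the lower stage at parameter `s + 4`, weakened to radius `M * R' s`
  obtain ⟨Ψ', hΨ'm, hΨ'loc0, hΨ'bad⟩ := hCloc e (s + 4) (by omega)
  have hΨ'loc : LocalAt S e (M * R' s) Ψ' := localAt_mono (hR' s) hΨ'loc0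
  -- upper surrogates at parameter `s` for every `ℤ⁴`-link
  choose Bap hBapm hBaploc hBapbad using fun e' : ZdEdge 4 => hBloc e' s hs
  -- the corner edges of the lower input ball and their lifts
  obtain ⟨B₂, hB₂⟩ : ∃ B₂ : Set (Edge 4 (2 * S + 1)), B₂ = inputBall (2 * S + 1) e (M * R' s) := ⟨_, rfl⟩
  obtain ⟨Q, hQ⟩ : ∃ Q : Finset (Edge 4 (2 * S + 1)),
      Q = Finset.univ.filter fun q => ∃ x ∈ B₂, cornerEdge M (2 * S + 1) x = q := ⟨_, rfl⟩
  have hQmem : ∀ q ∈ Q, ∃ x ∈ inputBall (2 * S + 1) e (M * R' s), cornerEdge M (2 * S + 1) x = q := by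
    intro q hq
    rw [hQ, Finset.mem_filter] at hq
    obtain ⟨x, hx, hxq⟩ := hq.2
    exact ⟨x, by rwa [hB₂] at hx, hxq⟩
  have hlift : ∀ q ∈ Q, ∃ e₁ : ZdEdge 4, torusEdge (2 * S + 1) e₁ = q ∧ supDist e₁.1 e.1 ≤ M * R' s + M ∧
      IsCornerLift M (2 * S + 1) e₁ := by
    intro q hq
    obtain ⟨x, hx, rfl⟩ := hQmem q hq
    exact exists_cornerLift hM hx
  choose! lift hlift₁ hlift₂ _hlift₃ using hlift
  have hcornerQ : ∀ x ∈ B₂, cornerEdge M (2 * S + 1) x ∈ Q := fun x hx => by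
    rw [hQ, Finset.mem_filter]; exact ⟨Finset.mem_univ _, x, hx, rfl⟩
  have hcard : (Q.card : ℝ) ≤ 64 * ((2 * R' s + 3 : ℕ) : ℝ) ^ 4 := by
    exact_mod_cast card_corners_le hM hMN e (R' s) Q hQmem
  -- the local surrogate of the reblocked upper output
  obtain ⟨W, hW⟩ : ∃ W : GaugeConfig 4 (2 * S + 1) G × Noise G (2 * S + 1) → GaugeConfig 4 (2 * S + 1) G,
      W = fun p x => Bap (lift (cornerEdge M (2 * S + 1) x)) (p.1, evenPart p.2) := ⟨_, rfl⟩
  have hWm : Measurable W := by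
    rw [hW]
    exact measurable_pi_lambda _ fun x => (hBapm _).comp (measurable_fst.prodMk (measurable_evenPart.comp measurable_snd))
  refine ⟨fun p => Ψ' (W p, oddPart p.2), hΨ'm.comp (hWm.prodMk (measurable_oddPart.comp measurable_snd)), ?_, ?_⟩
  · -- locality on the composite ball
    intro p q hV hω
    beta_reduce at hV hω
    refine hΨ'loc (W p, oddPart p.2) (W q, oddPart q.2) (fun x hx => ?_) (fun y hy => ?_)
    · have hxB : x ∈ B₂ := by rw [hB₂]; exact hx
      have hd := hlift₂ _ (hcornerQ x hxB)
      rw [hW]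
      refine hBaploc (lift (cornerEdge M (2 * S + 1) x)) _ _ (fun x' hx' => ?_) (fun y' hy' => ?_)
      · exact hV x' (inputBall_subset (by omega) hx')
      · show p.2 (parityIndex _ (0, y')) = q.2 (parityIndex _ (0, y'))
        refine hω _ ?_
        simp only [parityIndex_snd]
        exact inputBall_subset (by omega) hy'
    · show p.2 (parityIndex _ (1, y)) = q.2 (parityIndex _ (1, y))
      refine hω _ ?_
      simp only [parityIndex_snd]
      exact inputBall_mono e (by omega) hy
  · -- exceptional mass
    have hT : Measurable fun p : GaugeConfig 4 (2 * S + 1) G × Noise G (2 * S + 1) =>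
        (reblock M (2 * S + 1) (B (p.1, evenPart p.2)), oddPart p.2) :=
      ((measurable_reblock M (2 * S + 1)).comp
        (hB.comp (measurable_fst.prodMk (measurable_evenPart.comp measurable_snd)))).prodMk
        (measurable_oddPart.comp measurable_snd)
    have hE : Measurable fun p : GaugeConfig 4 (2 * S + 1) G × Noise G (2 * S + 1) => (p.1, evenPart p.2) :=
      measurable_fst.prodMk (measurable_evenPart.comp measurable_snd)
    have hlawT := law_lowerInput ρ β hM hB hBlaw
    have hlawE := law_upperInput ρ β (S := S) (M := t * M)
    -- pulled-back exceptional events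
    have hbadC : π₂ {p | C (reblock M (2 * S + 1) (B (p.1, evenPart p.2)), oddPart p.2) (torusEdge (2 * S + 1) e) ≠
        Ψ' (reblock M (2 * S + 1) (B (p.1, evenPart p.2)), oddPart p.2)} ≤ ENNReal.ofReal (T₁ (s + 4)) := by
      refine le_trans (Measure.le_map_apply hT.aemeasurable {r | C r (torusEdge (2 * S + 1) e) ≠ Ψ' r}) ?_
      rw [hπ₂, hlawT]
      exact hΨ'bad
    have hbadq : ∀ q ∈ Q, π₂ {p | B (p.1, evenPart p.2) (torusEdge (2 * S + 1) (lift q)) ≠ Bap (lift q) (p.1, evenPart p.2)} ≤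
        ENNReal.ofReal (K * Real.exp (-(s : ℝ))) := by
      intro q _
      refine le_trans (Measure.le_map_apply hE.aemeasurable
        {r | B r (torusEdge (2 * S + 1) (lift q)) ≠ Bap (lift q) r}) ?_
      rw [hπ₂, hlawE]
      exact hBapbad (lift q)
    -- off the exceptional events the composite output is the surrogate
    have hsub : {p | C (reblock M (2 * S + 1) (B (p.1, evenPart p.2)), oddPart p.2) (torusEdge (2 * S + 1) e) ≠
          Ψ' (W p, oddPart p.2)} ⊆
        {p | C (reblock M (2 * S + 1) (B (p.1, evenPart p.2)), oddPart p.2) (torusEdge (2 * S + 1) e) ≠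
          Ψ' (reblock M (2 * S + 1) (B (p.1, evenPart p.2)), oddPart p.2)} ∪
        ⋃ q ∈ Q, {p | B (p.1, evenPart p.2) (torusEdge (2 * S + 1) (lift q)) ≠ Bap (lift q) (p.1, evenPart p.2)} := by
      intro p hp
      by_contra hnot
      simp only [Set.mem_union, Set.mem_iUnion, Set.mem_setOf_eq, not_or, not_exists, not_not] at hnot
      obtain ⟨h1, h2⟩ := hnot
      apply hp
      rw [h1]
      refine hΨ'loc _ _ (fun x hx => ?_) (fun y _ => rfl)
      have hxB : x ∈ B₂ := by rw [hB₂]; exact hx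
      have hq := hcornerQ x hxB
      show B (p.1, evenPart p.2) (cornerEdge M (2 * S + 1) x) = W p x
      rw [hW]
      simp only
      rw [← h2 _ hq, hlift₁ _ hq]
    -- the union bound
    have hKe : 0 ≤ K * Real.exp (-(s : ℝ)) := mul_nonneg hK (Real.exp_pos _).le
    calc π₂ {p | C (reblock M (2 * S + 1) (B (p.1, evenPart p.2)), oddPart p.2) (torusEdge (2 * S + 1) e) ≠
            Ψ' (W p, oddPart p.2)}
        ≤ π₂ {p | C (reblock M (2 * S + 1) (B (p.1, evenPart p.2)), oddPart p.2) (torusEdge (2 * S + 1) e) ≠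
              Ψ' (reblock M (2 * S + 1) (B (p.1, evenPart p.2)), oddPart p.2)} +
          π₂ (⋃ q ∈ Q, {p | B (p.1, evenPart p.2) (torusEdge (2 * S + 1) (lift q)) ≠ Bap (lift q) (p.1, evenPart p.2)}) :=
          (measure_mono hsub).trans (measure_union_le _ _)
      _ ≤ ENNReal.ofReal (T₁ (s + 4)) + Q.card • ENNReal.ofReal (K * Real.exp (-(s : ℝ))) :=
          add_le_add hbadC ((measure_biUnion_finset_le _ _).trans (Finset.sum_le_card_nsmul _ _ _ hbadq))
      _ = ENNReal.ofReal (T₁ (s + 4) + (Q.card : ℝ) * (K * Real.exp (-(s : ℝ)))) := by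
          rw [ENNReal.ofReal_add (hT₁ _) (mul_nonneg (Nat.cast_nonneg _) hKe), ENNReal.ofReal_mul (Nat.cast_nonneg _),
            ENNReal.ofReal_natCast, nsmul_eq_mul]
      _ ≤ ENNReal.ofReal (T₁ (s + 4) + 64 * ((2 * R' s + 3 : ℕ) : ℝ) ^ 4 * (K * Real.exp (-(s : ℝ)))) :=
          ENNReal.ofReal_le_ofReal (by nlinarith [hcard, hKe])

end LocStep

/-! ## §S2.4 Arithmetic of the constants -/

section Arith

/-- `54 ≤ e⁴` (numerical). -/
theorem exp_four_ge : (54 : ℝ) ≤ Real.exp 4 := by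
  have h := Real.exp_one_gt_d9
  have h1 : Real.exp 4 = (Real.exp 1) ^ 4 := by
    rw [← Real.exp_nat_mul]; norm_num
  have h2 : (2.7182818283 : ℝ) ^ 4 ≤ (Real.exp 1) ^ 4 := pow_le_pow_left₀ (by norm_num) h.le 4
  rw [h1]
  nlinarith [h2]

/-- The tail constant of the graded invariant for block radius `b` and format constant `K' ≥ 0`. -/
def tailConst (b : ℕ) (K' : ℝ) : ℝ := (144 * ((16 * b + 3 : ℕ) : ℝ) ^ 4 + 1) * K'

/-- `0 ≤ tailConst b K'` for `K' ≥ 0`. -/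
theorem tailConst_nonneg (b : ℕ) {K' : ℝ} (hK' : 0 ≤ K') : 0 ≤ tailConst b K' := by
  unfold tailConst; positivity

/-- `K' ≤ tailConst b K'` for `K' ≥ 0`. -/
theorem le_tailConst (b : ℕ) {K' : ℝ} (hK' : 0 ≤ K') : K' ≤ tailConst b K' := by
  unfold tailConst; nlinarith [pow_nonneg (Nat.cast_nonneg (α := ℝ) (16 * b + 3)) 4]

/-- The one-step tail bookkeeping: `A (s+6)^4 e^{-(s+4)} + 64 (4bs+32b+5)^4 K' e^{-s} ≤ A (s+2)^4 e^{-s}` for `s ≥ 1`. -/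
theorem tail_step_arith (b : ℕ) {K' : ℝ} (hK' : 0 ≤ K') {s : ℕ} (hs : 1 ≤ s) :
    tailConst b K' * (((s + 4 : ℕ) : ℝ) + 2) ^ 4 * Real.exp (-((s + 4 : ℕ) : ℝ)) +
        64 * ((2 * (2 * b * s + 16 * b + 1) + 3 : ℕ) : ℝ) ^ 4 * (K' * Real.exp (-(s : ℝ))) ≤
      tailConst b K' * ((s : ℝ) + 2) ^ 4 * Real.exp (-(s : ℝ)) := by
  set A := tailConst b K' with hA
  set F : ℝ := ((16 * b + 3 : ℕ) : ℝ) ^ 4 with hF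
  have hA' : A = (144 * F + 1) * K' := rfl
  have hA0 : 0 ≤ A := tailConst_nonneg b hK'
  have hF0 : 0 ≤ F := by positivity
  set E := Real.exp (-(s : ℝ)) with hE
  have hE0 : 0 < E := Real.exp_pos _
  set e4 := Real.exp (-4) with he4
  have he40 : 0 < e4 := Real.exp_pos _
  have h54 : e4 * 54 ≤ 1 := by
    have hmul : e4 * Real.exp 4 = 1 := by rw [he4, ← Real.exp_add]; norm_num
    nlinarith [exp_four_ge]
  have hexp : Real.exp (-((s + 4 : ℕ) : ℝ)) = E * e4 := by
    rw [hE, he4, ← Real.exp_add]; push_cast; ring_nf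
  set X : ℝ := (((s + 4 : ℕ) : ℝ) + 2) ^ 4 with hX
  set Y : ℝ := ((s : ℝ) + 2) ^ 4 with hY
  have hY0 : 0 ≤ Y := by positivity
  have hXY : X ≤ 30 * Y := by
    have h1 : (3 * (s + 6)) ^ 4 ≤ (7 * (s + 2)) ^ 4 := Nat.pow_le_pow_left (by omega) 4
    have h2 : (((3 * (s + 6)) ^ 4 : ℕ) : ℝ) ≤ (((7 * (s + 2)) ^ 4 : ℕ) : ℝ) := by exact_mod_cast h1
    rw [hX, hY]; push_cast at h2 ⊢; nlinarith [h2]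
  set P : ℝ := ((2 * (2 * b * s + 16 * b + 1) + 3 : ℕ) : ℝ) ^ 4 with hP
  have hPY : P ≤ F * Y := by
    have h1 : (2 * (2 * b * s + 16 * b + 1) + 3) ^ 4 ≤ ((16 * b + 3) * (s + 2)) ^ 4 :=
      Nat.pow_le_pow_left (by nlinarith) 4
    have h2 : (((2 * (2 * b * s + 16 * b + 1) + 3) ^ 4 : ℕ) : ℝ) ≤ ((((16 * b + 3) * (s + 2)) ^ 4 : ℕ) : ℝ) := by
      exact_mod_cast h1
    rw [hP, hF, hY]; push_cast at h2 ⊢; nlinarith [h2]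
  have key : A * X * e4 + 64 * P * K' ≤ A * Y := by
    nlinarith [mul_le_mul_of_nonneg_left hXY (by positivity : 0 ≤ A * e4),
      mul_le_mul_of_nonneg_left h54 (by positivity : 0 ≤ A * 30 * Y),
      mul_le_mul_of_nonneg_left hPY (by positivity : 0 ≤ 64 * K')]
  rw [hexp]
  have hl : A * X * (E * e4) + 64 * P * (K' * E) = E * (A * X * e4 + 64 * P * K') := by ring
  have hr : A * Y * E = E * (A * Y) := by ring
  rw [hl, hr]
  exact mul_le_mul_of_nonneg_left key hE0.le

/-- The final re-indexing `s = 2k`: `A (2k+2)^4 e^{-2k} ≤ 384 e A e^{-k}`. -/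
theorem tail_final_arith {A : ℝ} (hA : 0 ≤ A) (k : ℕ) :
    A * (((2 * k : ℕ) : ℝ) + 2) ^ 4 * Real.exp (-((2 * k : ℕ) : ℝ)) ≤ 384 * Real.exp 1 * A * Real.exp (-(k : ℝ)) := by
  have h4 := pow_four_le_exp (k + 1)
  have hE0 : 0 < Real.exp (-(k : ℝ)) := Real.exp_pos _
  have hsq : Real.exp (-((2 * k : ℕ) : ℝ)) = Real.exp (-(k : ℝ)) * Real.exp (-(k : ℝ)) := by
    rw [← Real.exp_add]; push_cast; ring_nf
  have hk1 : Real.exp (((k + 1 : ℕ) : ℝ)) = Real.exp (k : ℝ) * Real.exp 1 := by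
    rw [← Real.exp_add]; push_cast; ring_nf
  have hinv : Real.exp (k : ℝ) * Real.exp (-(k : ℝ)) = 1 := by rw [← Real.exp_add]; simp
  have h16 : (((2 * k : ℕ) : ℝ) + 2) ^ 4 = 16 * (((k + 1 : ℕ) : ℝ)) ^ 4 := by push_cast; ring
  rw [hsq, h16]
  rw [hk1] at h4
  -- `A * (16 (k+1)^4) * (E * E) ≤ 384 e A E` since `(k+1)^4 E ≤ 24 e`
  have hmid : (((k + 1 : ℕ) : ℝ)) ^ 4 * Real.exp (-(k : ℝ)) ≤ 24 * Real.exp 1 := by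
    have := mul_le_mul_of_nonneg_right h4 hE0.le
    calc (((k + 1 : ℕ) : ℝ)) ^ 4 * Real.exp (-(k : ℝ)) ≤ 24 * (Real.exp (k : ℝ) * Real.exp 1) * Real.exp (-(k : ℝ)) := this
      _ = 24 * Real.exp 1 * (Real.exp (k : ℝ) * Real.exp (-(k : ℝ))) := by ring
      _ = 24 * Real.exp 1 := by rw [hinv, mul_one]
  have := mul_le_mul_of_nonneg_left hmid (by positivity : 0 ≤ 16 * A * Real.exp (-(k : ℝ)))
  nlinarith [this]

end Arith

end Summit.QuantumFields.YangMills.Cruxes.IR.SmallFieldPolymerCoder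

end
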